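import Literature.AlgebraicGeometry.AbelianSchemes.LevelBasisFiniteEtaleCoverSurjective
import Literature.AlgebraicGeometry.AbelianSchemes.AbelianSchemeOverHomNoetherianAnyBase
import HarnessLib

/-!
# The finite étale cover of level-`M` bases REALISES every basis WITH ITS VALUE
# ([MumfordFogartyKirwan1994] Prop. 7.3 step (IV): the tautological sections of `H₄` restrict to the given basis)

Layer `Literature/AlgebraicGeometry/AbelianSchemes`, namespace `Literature.AlgebraicGeometry.AbelianSchemes.AbelianSchemeOver`.
Cell `hodgecm-mathlib` (D-0151), F-DAG F-10 (b) «classify for `M/Γ`», step (b4) «the cover» (author B-p02 (g13); B-p06 (g11)'s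
census `F10b-CENSUS-SKELETON` §road 1).  PROOF lane, theorems only (every object is produced inside an `∃`); count-neutral capital.
HC_CM is proved only modulo the 7 printed citations until rung 0 closes; this file asserts nothing about HC.

Why this edition.  ★ `exists_finite_etale_levelStructure` (file `LevelBasisFiniteEtaleCover`, «C3») produces a finite étale
`b : B → S` with a level-`M` structure `η` on `A ×_S B` such that every ordered `ℤ/M`-basis `x` of the `M`-torsion of a fibre
`A_s̄(Ω)` lies UNDER SOME point `t` of `B` over `s̄` — but it does not export that the realised point carries the VALUE `x`:
«`η(t) = x`».  In [MumfordFogartyKirwan1994] Prop. 7.3 step (IV) this is automatic (the point of `H₄` IS the tuple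
`(τ₁(s̄), …, τ_{2g}(s̄))` and the level structure is tautological); the consumer (b4) of F-10 (b) needs it, because the
realised point must land in the REFINEMENT locus `{η.changeLevel = ψ}` and in the SYMPLECTIC-LIFTABLE locus, both of which
are conditions on the value `η(t)`.  This file re-runs the construction of C3 (basis locus `B ⊆ A[M]^{×_S 2g}`, graph
sections of the tautological points — ★ `exists_torsion_subscheme`, ★ `exists_power_finite_etale`, ★ `exists_pointSectionHom`,
★ `Morphisms/SectionEqualizerClopen`, ★ `exists_levelStructure_of_injective`) and exports the value in the transport-free
currency of underlying morphisms `Spec Ω → A`: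

  `((A ×_S B).restrict t (ψ.σ i)).left ≫ pr_A = (x i).left`      («`ηᵢ(t)` lies over `xᵢ`»),

which is `η(t) = x` read through ★ `fibrePointsBaseChangeEquiv b t` (whose underlying morphism to `A` is the identity on
points, `left_fibrePointsBaseChangeEquiv_comp_fst`) and through the `restrictPt` dictionary (★ `fibrePointToLeft_restrictPt`,
★ `eq_restrictPt_iff_eq_restrict`).

* `left_fibrePointsBaseChangeEquiv_comp_fst` — `(e y).left ≫ pr_A = y.left` for `e = fibrePointsBaseChangeEquiv b t`;
* **`exists_finite_etale_levelStructure_restrict_eq`** — C3 with the value clause (`[IsCommMonObj A.X]`);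
* **`exists_finite_etale_surjective_levelStructure_restrict_eq`** — plus `Surjective b` (C4's argument: every geometric
  fibre has a basis, ★ `exists_torsionBasis_fibrePoints`);
* `…_of_isLocallyNoetherian` — the same over a locally Noetherian base, `[IsCommMonObj A.X]` discharged by ★
  `isCommMonObj_of_isLocallyNoetherian_base`.

## References
* [MumfordFogartyKirwan1994] D. Mumford, J. Fogarty, F. Kirwan, *Geometric Invariant Theory*, 3rd ed. (1994), Ch. 7 §2
  Definition 7.1 (p. 129), Proposition 7.3, proof, step (IV) (pp. 133–134); Ch. 7 §3 Lemma 7.11 (p. 140).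
* [GortzWedhorn2023] U. Görtz, T. Wedhorn, *Algebraic Geometry II* (2023), Prop. 27.188 (1) (p. 675).
* [GortzWedhorn2020] U. Görtz, T. Wedhorn, *Algebraic Geometry I*, 2nd ed. (2020), Section (4.7), (4.7.1) (p. 108).
-/

noncomputable section

universe u

open CategoryTheory CategoryTheory.Limits AlgebraicGeometry MonoidalCategory CartesianMonoidalCategory

open scoped MonObj Obj

namespace Literature.AlgebraicGeometry.AbelianSchemes

namespace AbelianSchemeOver

open Literature.AlgebraicGeometry.Morphisms Literature.AlgebraicGeometry.Motives

variable {S : Scheme.{u}} (A : AbelianSchemeOver S)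

/-! ### §1 The fibre identification is the identity on underlying points of `A` -/

/-- **`(e y) ≫ pr_A = y` on underlying morphisms**, `e : A_{t ≫ b}(Ω) ≃ (A ×_S B)_t(Ω)` the adjunction equivalence
★ `fibrePointsBaseChangeEquiv b t` (`y ↦ unit_t ≫ (y ×_S B)`): the first projection of `y ×_S B` is `pr₁ ≫ y` and the unit
followed by `pr₁` is the identity. [cite: GortzWedhorn2020, Section (4.7), (4.7.1) (p. 108)] -/
theorem left_fibrePointsBaseChangeEquiv_comp_fst {B : Scheme.{u}} (b : B ⟶ S) {Ω : Type u} [Field Ω]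
    (t : Spec (.of Ω) ⟶ B) (y : A.FibrePoints (t ≫ b)) :
    (A.fibrePointsBaseChangeEquiv b t y).left ≫ pullback.fst A.X.hom b = y.left := by
  have e7 : ((Over.pullback b).map y).left ≫ pullback.fst A.X.hom b = pullback.fst (t ≫ b) b ≫ y.left :=
    pullback.lift_fst _ _ _
  have e5 : ((Over.mapPullbackAdj b).unit.app (Over.mk t)).left ≫ pullback.fst (t ≫ b) b = 𝟙 _ :=
    pullback.lift_fst _ _ _
  rw [A.fibrePointsBaseChangeEquiv_apply b t, Over.comp_left]
  erw [Category.assoc, e7, ← Category.assoc, e5, Category.id_comp]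

/-! ### §2 The cover of level-`M` bases, with values -/

/-- **THE FINITE ÉTALE COVER OF LEVEL-`M` BASES, WITH VALUES** ([MumfordFogartyKirwan1994] Prop. 7.3 step (IV) / Lemma 7.11;
[GortzWedhorn2023] Prop. 27.188 (1)).  Let `A/S` be an abelian scheme of relative dimension `g` with commutative group law, `M ≠ 0`
invertible in the residue fields of `S`.  There are a FINITE ÉTALE `b : B → S` and a level-`M` structure `η` on `A ×_S B` such
that every ordered `ℤ/M`-basis `x` of the `M`-torsion of a fibre `A_s̄(Ω)` (an `M`-torsion family on which `a ↦ Σ aᵢ xᵢ` is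
injective) IS THE VALUE of `η` at a point `t` of `B` over `s̄`: `t ≫ b = s̄` and `ηᵢ(t)` lies over `xᵢ` for every `i`.
Construction as in ★ `exists_finite_etale_levelStructure`: `B` = the open-and-closed basis locus of the `2g`-fold fibre power
`T = A[M] ×_S ⋯ ×_S A[M]` (★ `exists_torsion_subscheme`, ★ `exists_power_finite_etale`, ★ `Morphisms/SectionEqualizerClopen`),
`η` = the graph sections of the tautological points (★ `exists_pointSectionHom`, ★ `exists_levelStructure_of_injective`); the
realising point is the tautological lift of `x`, and the value clause is the compatibility of graph sections with restriction.
[cite: MumfordFogartyKirwan1994, Ch. 7 §2 Proposition 7.3, proof, step (IV) (pp. 133–134)]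
[cite: MumfordFogartyKirwan1994, Ch. 7 §3 Lemma 7.11 (p. 140)] [cite: GortzWedhorn2023, Prop. 27.188 (1) (p. 675)] -/
theorem exists_finite_etale_levelStructure_restrict_eq [IsCommMonObj A.X] {g M : ℕ} [NeZero M] (hg : A.IsOfRelDim g)
    (hM : ∀ s : S, (M : S.residueField s) ≠ 0) :
    ∃ (B : Scheme.{u}) (b : B ⟶ S) (ψ : LevelStructure g M (A.baseChange b)), IsFinite b ∧ Etale b ∧
      ∀ ⦃Ω : Type u⦄ [Field Ω] (s : Spec (.of Ω) ⟶ S) (x : Fin g ⊕ Fin g → A.FibrePoints s),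
        (∀ i, x i ^ M = 1) →
        Function.Injective (fun a : Fin g ⊕ Fin g → ZMod M =>
          (List.ofFn fun i : Fin g => x (Sum.inl i) ^ (a (Sum.inl i)).val).prod *
            (List.ofFn fun i : Fin g => x (Sum.inr i) ^ (a (Sum.inr i)).val).prod) →
        ∃ t : Spec (.of Ω) ⟶ B, t ≫ b = s ∧
          ∀ i, ((A.baseChange b).restrict t (ψ.σ i)).left ≫ pullback.fst A.X.hom b = (x i).left := by
  classical
  -- adapted from ★ `exists_finite_etale_levelStructure` (same construction, the value clause exported)
  -- §1: `A[M]` and the tautological `2g`-fold power `T`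
  obtain ⟨AM, incl, hfin, het, hpow, hlift, hinj⟩ := A.exists_torsion_subscheme hM
  haveI := hfin
  haveI := het
  obtain ⟨T, π, hTfin, hTet, hTex, hTuniq⟩ := exists_power_finite_etale AM (Fin g ⊕ Fin g)
  haveI := hTfin
  haveI := hTet
  -- the `T`-points `Σ aᵢ τᵢ` of `A` and their factorisations through `A[M]`
  obtain ⟨P, hP⟩ : ∃ P : (Fin g ⊕ Fin g → ZMod M) → (T ⟶ A.X), ∀ a, P a =
      (List.ofFn fun i : Fin g => (π (Sum.inl i) ≫ incl) ^ (a (Sum.inl i)).val).prod *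
        (List.ofFn fun i : Fin g => (π (Sum.inr i) ≫ incl) ^ (a (Sum.inr i)).val).prod := ⟨_, fun a => rfl⟩
  have hPpow : ∀ a, P a ^ M = 1 := fun a => by
    rw [hP]
    exact listProd_pow_mul_listProd_pow_pow_eq_one (fun i => π i ≫ incl) (fun i => hpow T (π i)) a
  choose p hp using fun a => hlift T (P a) (hPpow a)
  -- precomposition with an `S`-morphism distributes over `Σ aᵢ τᵢ`
  have hPcomp : ∀ {Y : Over S} (u : Y ⟶ T) (a : Fin g ⊕ Fin g → ZMod M), u ≫ P a =
      (List.ofFn fun i : Fin g => (u ≫ π (Sum.inl i) ≫ incl) ^ (a (Sum.inl i)).val).prod *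
        (List.ofFn fun i : Fin g => (u ≫ π (Sum.inr i) ≫ incl) ^ (a (Sum.inr i)).val).prod := by
    intro Y u a
    rw [hP]
    exact map_listProd_pow_mul_listProd_pow (MonoidHom.mk' (fun f : T ⟶ A.X => u ≫ f) (MonObj.comp_mul u))
      (fun i => π i ≫ incl) a
  -- §2: the equality loci of `Σ aᵢ τᵢ`, `Σ bᵢ τᵢ` are open and closed (sections of the finite étale `A[M]_T → T`)
  obtain ⟨σ, hσ⟩ : ∃ σ : (Fin g ⊕ Fin g → ZMod M) → (T.left ⟶ pullback AM.hom T.hom),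
      ∀ a, σ a = pullback.lift (p a).left (𝟙 _) (by rw [Category.id_comp]; exact Over.w (p a)) := ⟨_, fun a => rfl⟩
  have hσq : ∀ a b, σ a ≫ pullback.snd AM.hom T.hom = σ b ≫ pullback.snd AM.hom T.hom := fun a b => by
    rw [hσ, hσ, pullback.lift_snd, pullback.lift_snd]
  have hE : ∀ a b, IsClopen (Set.range (pullback.snd (pullback.diagonal (pullback.snd AM.hom T.hom))
      (pullback.lift (σ a) (σ b) (hσq a b))).base) := fun a b => isClopen_range_sectionEqualizer (hσq a b)
  -- «`x ≫ Σ aᵢτᵢ = x ≫ Σ bᵢτᵢ` iff `x` lands in the equality locus», for field-valued `x : Spec Ω → T`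
  have hiff : ∀ (a b) {Ω : Type u} [Field Ω] (x : Spec (.of Ω) ⟶ T.left),
      x ≫ (P a).left = x ≫ (P b).left ↔ x.base (IsLocalRing.closedPoint Ω) ∈
        Set.range (pullback.snd (pullback.diagonal (pullback.snd AM.hom T.hom))
          (pullback.lift (σ a) (σ b) (hσq a b))).base := by
    intro a b Ω _ x
    have hrange : Set.range x.base ⊆ Set.range (pullback.snd (pullback.diagonal (pullback.snd AM.hom T.hom))
        (pullback.lift (σ a) (σ b) (hσq a b))).base ↔ x.base (IsLocalRing.closedPoint Ω) ∈ _ :=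
      ⟨fun h => h ⟨_, rfl⟩, fun h => by
        rintro _ ⟨q, rfl⟩
        rwa [Subsingleton.elim q (IsLocalRing.closedPoint Ω)]⟩
    rw [← hrange, ← comp_eq_comp_iff_range_subset_sectionEqualizer (hσq a b) x]
    have hleft : ∀ c, (p c).left ≫ incl.left = (P c).left := fun c => by rw [← Over.comp_left, hp]
    constructor
    · intro h
      have hx : (x ≫ (p a).left) ≫ AM.hom = x ≫ T.hom := by rw [Category.assoc, Over.w (p a)]
      have hx' : (x ≫ (p b).left) ≫ AM.hom = x ≫ T.hom := by rw [Category.assoc, Over.w (p b)]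
      have hw := hinj (Over.mk (x ≫ T.hom)) (Over.homMk (x ≫ (p a).left) hx) (Over.homMk (x ≫ (p b).left) hx')
        (Over.OverMorphism.ext (by
          change (x ≫ (p a).left) ≫ incl.left = (x ≫ (p b).left) ≫ incl.left
          rw [Category.assoc, Category.assoc, hleft, hleft, h]))
      have hw' : x ≫ (p a).left = x ≫ (p b).left := congrArg Over.Hom.left hw
      apply pullback.hom_ext
      · erw [Category.assoc, Category.assoc, hσ, pullback.lift_fst, hσ, pullback.lift_fst]
        exact hw'
      · erw [Category.assoc, Category.assoc, hσ, pullback.lift_snd, hσ, pullback.lift_snd]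
    · intro h
      have h' := congrArg (· ≫ pullback.fst AM.hom T.hom) h
      erw [Category.assoc, Category.assoc, hσ, pullback.lift_fst, hσ, pullback.lift_fst] at h'
      rw [← hleft, ← hleft, ← Category.assoc, ← Category.assoc, h']
  -- the basis locus `U` and the injectivity it encodes
  obtain ⟨U, hU⟩ : ∃ U : Set T.left, U = ⋂ q : {q : (Fin g ⊕ Fin g → ZMod M) × (Fin g ⊕ Fin g → ZMod M) // q.1 ≠ q.2},
      (Set.range (pullback.snd (pullback.diagonal (pullback.snd AM.hom T.hom))
        (pullback.lift (σ q.1.1) (σ q.1.2) (hσq q.1.1 q.1.2))).base)ᶜ := ⟨_, rfl⟩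
  have hUclopen : IsClopen U := by
    rw [hU]
    exact isClopen_iInter_of_finite fun q => (hE q.1.1 q.1.2).compl
  have hUiff : ∀ {Ω : Type u} [Field Ω] (x : Spec (.of Ω) ⟶ T.left),
      x.base (IsLocalRing.closedPoint Ω) ∈ U ↔ Function.Injective fun a => x ≫ (P a).left := by
    intro Ω _ x
    rw [hU, Set.mem_iInter]
    constructor
    · intro h a b hab
      by_contra hne
      exact h ⟨(a, b), hne⟩ ((hiff a b x).1 hab)
    · rintro h ⟨⟨a, b⟩, hne⟩ hmem
      exact hne (h ((hiff a b x).2 hmem))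
  -- the cover `B := U ↪ T → S`
  let U' : T.left.Opens := ⟨U, hUclopen.isOpen⟩
  obtain ⟨hfinι, hetι⟩ := isFinite_and_etale_ι_of_isClosed U' hUclopen.isClosed
  haveI := hfinι
  haveI := hetι
  -- the level structure on `A ×_S B`: graph sections of the tautological points, injective on geometric fibres
  obtain ⟨ps, hps⟩ := A.exists_pointSectionHom (U'.ι ≫ T.hom)
  obtain ⟨w₀, hw₀⟩ : ∃ w₀ : Over.mk (U'.ι ≫ T.hom) ⟶ T, w₀.left = U'.ι := ⟨Over.homMk U'.ι rfl, rfl⟩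
  have hτM : ∀ i, ps (w₀ ≫ π i ≫ incl) ^ M = 1 := fun i => by
    rw [← map_pow, ← Category.assoc, hpow, map_one]
  have hsp : ∀ a, (A.baseChange (U'.ι ≫ T.hom)).sectionPow (fun i => ps (w₀ ≫ π i ≫ incl)) a = ps (w₀ ≫ P a) :=
    fun a => by
    rw [hPcomp]
    exact (map_listProd_pow_mul_listProd_pow ps (fun i => w₀ ≫ π i ≫ incl) a).symm
  obtain ⟨φ, hφ⟩ := (A.baseChange (U'.ι ≫ T.hom)).exists_levelStructure_of_injective (hg.baseChange _)
    (fun t => natCast_residueField_ne_zero_of_hom (U'.ι ≫ T.hom) hM t) (fun i => ps (w₀ ≫ π i ≫ incl)) hτM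
    (fun Ω _ _ t => by
      obtain ⟨pt, hpt⟩ : ∃ pt : Over.mk (t ≫ U'.ι ≫ T.hom) ⟶ Over.mk (U'.ι ≫ T.hom), pt.left = t :=
        ⟨Over.homMk t rfl, rfl⟩
      have hfun : (fun a : Fin g ⊕ Fin g → ZMod M =>
          (A.baseChange (U'.ι ≫ T.hom)).restrict t
            ((A.baseChange (U'.ι ≫ T.hom)).sectionPow (fun i => ps (w₀ ≫ π i ≫ incl)) a)) =
          fun a => A.fibrePointsBaseChangeEquiv (U'.ι ≫ T.hom) t (pt ≫ w₀ ≫ P a) := by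
        funext a
        rw [hsp, hps t pt hpt]
      rw [hfun]
      have hmem : (t ≫ U'.ι).base (IsLocalRing.closedPoint Ω) ∈ U := by
        rw [Scheme.Hom.comp_base, TopCat.coe_comp, Function.comp_apply]
        exact (t.base (IsLocalRing.closedPoint Ω)).2
      have hinjx := (hUiff (t ≫ U'.ι)).1 hmem
      intro a a' h
      apply hinjx
      have h' := congrArg Over.Hom.left ((A.fibrePointsBaseChangeEquiv (U'.ι ≫ T.hom) t).injective h)
      rw [Over.comp_left, Over.comp_left, Over.comp_left, Over.comp_left, hpt, hw₀, ← Category.assoc,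
        ← Category.assoc] at h'
      exact h')
  refine ⟨U', U'.ι ≫ T.hom, φ, inferInstance, inferInstance, fun Ω _ s x hxM hxinj => ?_⟩
  -- realisation: a basis `x` at `s̄` is a `T`-point of `A[M]^{2g}` landing in `U`
  choose w hw using fun i => hlift (Over.mk s) (x i) (hxM i)
  obtain ⟨u, hu⟩ := hTex (Over.mk s) w
  have hux : ∀ i, u ≫ π i ≫ incl = x i := fun i => by rw [← Category.assoc, hu, hw]
  obtain ⟨ul, hul⟩ : ∃ ul : Spec (.of Ω) ⟶ T.left, ul = u.left := ⟨u.left, rfl⟩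
  have hmem : ul.base (IsLocalRing.closedPoint Ω) ∈ U := by
    rw [hUiff ul]
    intro a a' h
    apply hxinj
    have h1 : ∀ c, ul ≫ (P c).left = (u ≫ P c).left := fun c => by rw [hul, Over.comp_left]; rfl
    dsimp only at h ⊢
    rw [h1, h1] at h
    have h2 := Over.OverMorphism.ext h
    rw [hPcomp, hPcomp] at h2
    simp only [hux] at h2
    exact h2
  have hrange : Set.range ul.base ⊆ Set.range U'.ι.base := by
    rintro _ ⟨q, rfl⟩
    rw [Scheme.Opens.range_ι, Subsingleton.elim q (IsLocalRing.closedPoint Ω)]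
    exact hmem
  have hfac : IsOpenImmersion.lift U'.ι ul hrange ≫ U'.ι = ul := IsOpenImmersion.lift_fac _ _ _
  refine ⟨IsOpenImmersion.lift U'.ι ul hrange, ?_, fun i => ?_⟩
  · rw [← Category.assoc, hfac, hul]
    exact Over.w u
  · -- the value: `ηᵢ(t) = e (pt ≫ w₀ ≫ τᵢ)` (graph sections restrict to the tautological point), and `pt ≫ w₀ = u`
    obtain ⟨pt, hpt⟩ : ∃ pt : Over.mk (IsOpenImmersion.lift U'.ι ul hrange ≫ U'.ι ≫ T.hom) ⟶ Over.mk (U'.ι ≫ T.hom),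
        pt.left = IsOpenImmersion.lift U'.ι ul hrange := ⟨Over.homMk _ rfl, rfl⟩
    have hσi : φ.σ i = ps (w₀ ≫ π i ≫ incl) := by rw [hφ]
    have hptw : (pt ≫ w₀).left = u.left := by
      rw [Over.comp_left, hpt, hw₀, ← hul]
      exact hfac
    have hre : pt ≫ w₀ ≫ π i ≫ incl = (pt ≫ w₀) ≫ π i ≫ incl := (Category.assoc _ _ _).symm
    rw [hσi, hps _ pt hpt (w₀ ≫ π i ≫ incl), A.left_fibrePointsBaseChangeEquiv_comp_fst, hre, Over.comp_left, hptw]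
    exact congrArg Over.Hom.left (hux i)

/-- **The cover of level-`M` bases with values is SURJECTIVE**: every geometric fibre `A_s̄(Ω)` has an ordered `ℤ/M`-basis
of its `M`-torsion (★ `exists_torsionBasis_fibrePoints`), realised by a point of `B` over `s̄` (as in ★
`exists_finite_etale_surjective_levelStructure`). [cite: MumfordFogartyKirwan1994, Ch. 7 §2 Proposition 7.3, proof, step (IV) (pp. 133–134)]
[cite: MumfordFogartyKirwan1994, Ch. 7 §3 Lemma 7.11 (p. 140)] [cite: GortzWedhorn2023, Prop. 27.188 (1) (p. 675)] -/
theorem exists_finite_etale_surjective_levelStructure_restrict_eq [IsCommMonObj A.X] {g M : ℕ} [NeZero M]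
    (hg : A.IsOfRelDim g) (hM : ∀ s : S, (M : S.residueField s) ≠ 0) :
    ∃ (B : Scheme.{u}) (b : B ⟶ S) (ψ : LevelStructure g M (A.baseChange b)), IsFinite b ∧ Etale b ∧ Surjective b ∧
      ∀ ⦃Ω : Type u⦄ [Field Ω] (s : Spec (.of Ω) ⟶ S) (x : Fin g ⊕ Fin g → A.FibrePoints s),
        (∀ i, x i ^ M = 1) →
        Function.Injective (fun a : Fin g ⊕ Fin g → ZMod M =>
          (List.ofFn fun i : Fin g => x (Sum.inl i) ^ (a (Sum.inl i)).val).prod *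
            (List.ofFn fun i : Fin g => x (Sum.inr i) ^ (a (Sum.inr i)).val).prod) →
        ∃ t : Spec (.of Ω) ⟶ B, t ≫ b = s ∧
          ∀ i, ((A.baseChange b).restrict t (ψ.σ i)).left ≫ pullback.fst A.X.hom b = (x i).left := by
  obtain ⟨B, b, ψ, hfin, het, hreal⟩ := A.exists_finite_etale_levelStructure_restrict_eq hg hM
  refine ⟨B, b, ψ, hfin, het, ⟨fun p => ?_⟩, hreal⟩
  -- adapted from ★ `exists_finite_etale_surjective_levelStructure`
  let Ω : Type u := AlgebraicClosure (S.residueField p)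
  let s₀ : Spec (.of Ω) ⟶ S :=
    Spec.map (CommRingCat.ofHom (algebraMap (S.residueField p) Ω)) ≫ S.fromSpecResidueField p
  have hs₀ : s₀.base (IsLocalRing.closedPoint Ω) = p := by
    change (S.fromSpecResidueField p).base _ = p
    exact Scheme.fromSpecResidueField_apply p _
  have hMΩ : (M : Ω) ≠ 0 := natCast_ne_zero_of_residueField s₀ M hM
  obtain ⟨x, hxM, hxinj⟩ := A.exists_torsionBasis_fibrePoints s₀ hg (NeZero.pos M) hMΩ
  obtain ⟨t, ht, -⟩ := hreal s₀ x hxM hxinj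
  refine ⟨t.base (IsLocalRing.closedPoint Ω), ?_⟩
  rw [← Scheme.Hom.comp_apply, ht, hs₀]

/-- **The surjective cover with values over a locally Noetherian base** (commutativity of the group law discharged by ★
`isCommMonObj_of_isLocallyNoetherian_base`). [cite: MumfordFogartyKirwan1994, Ch. 7 §2 Proposition 7.3, proof, step (IV) (pp. 133–134)]
[cite: GortzWedhorn2023, Prop. 27.188 (1) (p. 675)] -/
theorem exists_finite_etale_surjective_levelStructure_restrict_eq_of_isLocallyNoetherian [IsLocallyNoetherian S]
    {g M : ℕ} [NeZero M] (hg : A.IsOfRelDim g) (hM : ∀ s : S, (M : S.residueField s) ≠ 0) :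
    letI := A.isCommMonObj_of_isLocallyNoetherian_base
    ∃ (B : Scheme.{u}) (b : B ⟶ S) (ψ : LevelStructure g M (A.baseChange b)), IsFinite b ∧ Etale b ∧ Surjective b ∧
      ∀ ⦃Ω : Type u⦄ [Field Ω] (s : Spec (.of Ω) ⟶ S) (x : Fin g ⊕ Fin g → A.FibrePoints s),
        (∀ i, x i ^ M = 1) →
        Function.Injective (fun a : Fin g ⊕ Fin g → ZMod M =>
          (List.ofFn fun i : Fin g => x (Sum.inl i) ^ (a (Sum.inl i)).val).prod *
            (List.ofFn fun i : Fin g => x (Sum.inr i) ^ (a (Sum.inr i)).val).prod) →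
        ∃ t : Spec (.of Ω) ⟶ B, t ≫ b = s ∧
          ∀ i, ((A.baseChange b).restrict t (ψ.σ i)).left ≫ pullback.fst A.X.hom b = (x i).left := by
  letI := A.isCommMonObj_of_isLocallyNoetherian_base
  exact A.exists_finite_etale_surjective_levelStructure_restrict_eq hg hM

end AbelianSchemeOver

end Literature.AlgebraicGeometry.AbelianSchemes

end
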